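import Literature.Probability.LatticeModels.AnnulusManeuver
import HarnessLib

/-!
# The circuit maneuver `NE-cw`: crossings of annuli around a north-eastward slit

Topic `Literature/Probability/LatticeModels`; a sibling of `AnnulusManeuver.lean` (same `MStep`
machinery, region `mW c k` = the closed box of radius `48k` about `c`, free chain `chainM`, killed
chain `chainN` of `ManeuverChain.lean`), with a different step list. It is the lattice half of
D. Chelkak's "crossings of annuli" lemma (Chelkak 2016, Lemma 2.12), in the form consumed by the
corrected boundary-decay lemma (his Lemma 2.14) for the edge-killed walk near the tip of a slit
pointing north-east (landing direction within `22.62°` of north-east, clockwise circuit).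

Statement. In units of `k` relative to the centre `c`, the free simple random walk started in the
box `[20k, 28k] × [-9k, -k]` performs, with probability at least a universal constant
`circNEcwConst > 0` (`circNEcwConst_pos`, `circNEcwConst_le_chainM`), the clockwise circuit
"right strip top → bottom (the part below the slit), turn, bottom strip right → left, turn, left
strip bottom → top (full), turn, top strip left → right up to `x = -6k`" (`circNEcw`, ten steps),
inside `mW c k` (`circNEcwU_subset_mW`, `circNEcwL_subset_mW`), never entering the north-eastward
slit wedge `{z : X ≥ -2, Y ≥ -2, 7X - 17Y ≤ 23, 7Y - 17X ≤ 23}` (`X = z₀ - c₀ + 6k`,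
`Y = z₁ - c₁ + 6k`) nor the box `-8k ≤ z₀ - c₀, z₁ - c₁ ≤ -4k` (`circNEcw_avoids`); and a positive
KILLED chain at a start point `x ∈ S` with `x₁ ≥ c₁ - 9k` yields four strip crossings inside `S`:
a bottom–top crossing of the right strip from height `c₁ - 36k` to `c₁ - 9k`, a left–right
crossing of the bottom strip, a bottom–top crossing of the full left strip, and a left–right
crossing of the top strip from `c₀ - 36k` to `c₀ - 9k` (`circNEcw_crossings_of_chainN_pos`).

Proof: as in `AnnulusManeuver.lean` — the design checks `L i ⊆ T (i+1)` etc. by `omega`, the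
free chain by downward induction with `MStep.lower_bound` (every step has `8 ≤ w, 8 ≤ h`), the
crossings by iterating `exists_walk_of_chainN_pos` and cutting slabs out of the walks of steps
`0, 3, 6, 9` (`exists_subwalk_slab`). Everything is proved.

## References

* D. Chelkak, Robust discrete complex analysis: a toolbox, Ann. Probab. 44 (2016) 628–683,
  Lemma 2.12 (crossings of annuli), Lemma 2.14 — bib key `Chelkak2016`.
* S. Smirnov, Ann. of Math. 172 (2010) 1435–1467, App. B, Lemma B.2 — bib key `Smirnov2010`.
-/

noncomputable section

namespace Literature.Probability.LatticeModels

open Set SimpleGraph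

/-! ### The ten steps -/

/-- **The clockwise circuit for a north-eastward slit** (units of `k`, centre `c`): right strip
(below the slit) top → bottom, turn, bottom strip right → left, turn, full left strip
bottom → top, turn, top strip left → right up to `-6k`; all inside `[-48, 48]²`. Landing sets are
middle halves of exit sides, start sets transverse middle thirds, and each landing set lies in the
next start set. [cite: Chelkak2016, Lemma 2.12] -/
def circNEcw : Fin 10 → MStep :=
  ![⟨12, -40, 24, 40, 3⟩, ⟨6, -44, 35, 8, 0⟩, ⟨37, -46, 8, 22, 1⟩, ⟨-40, -36, 86, 24, 2⟩,
    ⟨-44, -41, 8, 35, 3⟩, ⟨-46, -45, 22, 8, 0⟩, ⟨-36, -46, 24, 86, 1⟩, ⟨-42, 24, 36, 20, 3⟩,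
    ⟨-44, 16, 40, 16, 2⟩, ⟨-46, 12, 40, 24, 0⟩]

section NEcw
variable (c : Site 2) (k : ℕ)

/-- Rectangles of the circuit (empty beyond the tenth). [folklore] -/
def circNEcwU (i : ℕ) : Set (Site 2) := if h : i < 10 then (circNEcw ⟨i, h⟩).U c k else ∅
/-- Landing sets of the circuit. [folklore] -/
def circNEcwL (i : ℕ) : Set (Site 2) := if h : i < 10 then (circNEcw ⟨i, h⟩).L c k else ∅
/-- Start sets of the circuit (everything beyond the tenth). [folklore] -/
def circNEcwT (i : ℕ) : Set (Site 2) := if h : i < 10 then (circNEcw ⟨i, h⟩).T c k else Set.univ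
/-- Step constants (`1` beyond the tenth). [folklore] -/
def circNEcwStepConst (i : ℕ) : ℝ := if h : i < 10 then (circNEcw ⟨i, h⟩).const else 1
/-- The circuit constant `∏_{i<10} c_i`. [folklore] -/
def circNEcwConst : ℝ := ∏ i ∈ Finset.range 10, circNEcwStepConst i

/-! ### Constants -/

/-- The step constants are positive. [folklore] -/
theorem circNEcwStepConst_pos (i : ℕ) : 0 < circNEcwStepConst i := by
  unfold circNEcwStepConst; split_ifs with h
  · apply MStep.const_pos <;> interval_cases i <;> simp [circNEcw]
  · exact one_pos

/-- **The circuit constant is positive** (a universal constant). [folklore] -/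
theorem circNEcwConst_pos : 0 < circNEcwConst := by
  exact Finset.prod_pos fun i _ => circNEcwStepConst_pos i

/-- The tail products `∏_{i ≤ j < 10} c_j`. [folklore] -/
def circNEcwTailConst (i : ℕ) : ℝ := ∏ j ∈ Finset.Ico i 10, circNEcwStepConst j

/-- Tail products are positive. [folklore] -/
theorem circNEcwTailConst_pos (i : ℕ) : 0 < circNEcwTailConst i :=
  Finset.prod_pos fun j _ => circNEcwStepConst_pos j

/-- `tail i = c_i · tail (i+1)` for `i < 10`. [folklore] -/
theorem circNEcwTailConst_succ {i : ℕ} (hi : i < 10) :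
    circNEcwTailConst i = circNEcwStepConst i * circNEcwTailConst (i + 1) := by
  unfold circNEcwTailConst
  rw [Finset.prod_eq_prod_Ico_succ_bot hi]

/-! ### Design checks -/

/-- **The rectangles lie in the region `mW c k`.** [folklore] -/
theorem circNEcwU_subset_mW : ∀ i, circNEcwU c k i ⊆ mW c k := by
  intro i x hx
  by_cases hi : i < 10
  · simp only [mW, Set.mem_setOf_eq, abs_le]
    interval_cases i <;>
      simp only [circNEcwU, circNEcw, MStep.U, MStep.corner, rectInterior,
        Matrix.cons_val_zero, Matrix.cons_val_one] at hx <;>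
      simp at hx <;> omega
  · simp [circNEcwU, hi] at hx

/-- **The landing sets lie in the region `mW c k`.** [folklore] -/
theorem circNEcwL_subset_mW : 0 < k → ∀ i, circNEcwL c k i ⊆ mW c k := by
  intro hk i x hx
  by_cases hi : i < 10
  · simp only [mW, Set.mem_setOf_eq, abs_le]
    interval_cases i <;>
      simp only [circNEcwL, circNEcw, MStep.L] at hx <;>
      simp at hx <;> omega
  · simp [circNEcwL, hi] at hx

/-- The rectangles are finite. [folklore] -/
theorem circNEcwU_finite : ∀ i, (circNEcwU c k i).Finite := by
  intro i
  unfold circNEcwU; split_ifs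
  · exact rectInterior_finite _ _ _
  · exact Set.finite_empty

/-- **Landing sets are disjoint from their (open) rectangles.** [folklore] -/
theorem disjoint_circNEcwU_L : ∀ i, Disjoint (circNEcwU c k i) (circNEcwL c k i) := by
  intro i
  rw [Set.disjoint_left]
  intro x hxU hxL
  by_cases hi : i < 10
  · interval_cases i <;>
      simp only [circNEcwU, circNEcwL, circNEcw, MStep.L, MStep.U, MStep.corner, rectInterior,
        Matrix.cons_val_zero, Matrix.cons_val_one] at hxU hxL <;>
      simp at hxU hxL <;> omega
  · simp [circNEcwU, hi] at hxU

/-- **Design check: each landing set lies in the next start set.** [folklore] -/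
theorem circNEcwL_subset_T (hk : 0 < k) {i : ℕ} (hi : i < 10) : circNEcwL c k i ⊆ circNEcwT c k (i + 1) := by
  intro x hx
  interval_cases i <;>
    simp only [circNEcwL, circNEcwT, circNEcw, MStep.L, MStep.T, MStep.U, MStep.corner, rectInterior, Set.mem_setOf_eq,
      Matrix.cons_val_zero, Matrix.cons_val_one,
      show (9 : ℕ) + 1 < 10 ↔ False by decide, dite_false, Set.mem_univ] at hx ⊢ <;>
    simp at hx ⊢ <;> omega

/-- Start sets lie in their rectangles. [folklore] -/
theorem circNEcwT_subset_U {i : ℕ} (hi : i < 10) : circNEcwT c k i ⊆ circNEcwU c k i := by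
  intro x hx
  simp only [circNEcwT, circNEcwU, dif_pos hi] at hx ⊢
  exact hx.1

/-- **Design check: the start box `[20k, 28k] × [-9k, -k]` lies in the first start set.** [folklore] -/
theorem circNEcw_start : 0 < k → ∀ x : Site 2, 20 * k ≤ x 0 - c 0 → x 0 - c 0 ≤ 28 * k → -9 * (k : ℤ) ≤ x 1 - c 1 →
    x 1 - c 1 ≤ -1 * k → x ∈ circNEcwT c k 0 := by
  intro hk x h0 h0' h1 h1'
  simp only [circNEcwT, circNEcw, MStep.T, MStep.U, MStep.corner, rectInterior, Set.mem_setOf_eq,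
    Matrix.cons_val_zero, Matrix.cons_val_one, show (0 : ℕ) < 10 by decide, dite_true]
  simp
  omega

/-- **Design check: the circuit avoids the germ box and the north-eastward slit wedge.** Every
site of a rectangle or landing set lies outside the box `-8k ≤ z₀ - c₀, z₁ - c₁ ≤ -4k` and
outside the wedge `{X ≥ -2, Y ≥ -2, 7X - 17Y ≤ 23, 7Y - 17X ≤ 23}` (`X = z₀ - c₀ + 6k`,
`Y = z₁ - c₁ + 6k`) about the slit tip `c - (6k, 6k)`. [folklore] -/
theorem circNEcw_avoids : 5 ≤ k → ∀ i, ∀ z ∈ circNEcwU c k i ∪ circNEcwL c k i,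
    (z 0 - c 0 < -8 * k ∨ -4 * (k : ℤ) < z 0 - c 0 ∨ z 1 - c 1 < -8 * k ∨ -4 * (k : ℤ) < z 1 - c 1) ∧
    (z 0 - c 0 + 6 * k < -2 ∨ z 1 - c 1 + 6 * k < -2 ∨
      23 < 7 * (z 0 - c 0 + 6 * k) - 17 * (z 1 - c 1 + 6 * k) ∨ 23 < 7 * (z 1 - c 1 + 6 * k) - 17 * (z 0 - c 0 + 6 * k)) := by
  intro hk i z hz
  by_cases hi : i < 10
  · interval_cases i <;>
      simp only [circNEcwU, circNEcwL, circNEcw, MStep.L, MStep.U, MStep.corner, rectInterior, Set.mem_union,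
        Matrix.cons_val_zero, Matrix.cons_val_one] at hz <;>
      simp at hz <;> omega
  · simp [circNEcwU, circNEcwL, hi] at hz

/-! ### The free chain is bounded below on the start set -/

/-- **The free chain is at least the tail product on the start sets**: by downward induction
with the one-step lower bound and the design check `L i ⊆ T (i+1)`. [folklore] -/
theorem circNEcwTailConst_le_chainM (hk : 0 < k) {j : ℕ} (hj : j ≤ 10) {x : Site 2} (hx : x ∈ circNEcwT c k (10 - j)) :
    circNEcwTailConst (10 - j) ≤ chainM (circNEcwU c k) (circNEcwL c k) 10 j x := by
  classical
  induction j generalizing x with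
  | zero => simp [circNEcwTailConst, chainM]
  | succ j ih =>
    have hi : 10 - (j + 1) < 10 := by omega
    set i := 10 - (j + 1) with hidef
    have hi' : 10 - 1 - j = i := by omega
    have hsucc : 10 - j = i + 1 := by omega
    simp only [chainM, hi']
    rw [circNEcwTailConst_succ hi]
    -- the data `g = 1_{L i} · M_j`
    have hM0 : ∀ w, 0 ≤ chainM (circNEcwU c k) (circNEcwL c k) 10 j w :=
      fun w => (chainM_mem_Icc (circNEcwU_finite c k) j w).1
    have hT : ∀ w ∈ circNEcwL c k i, circNEcwTailConst (i + 1) ≤ chainM (circNEcwU c k) (circNEcwL c k) 10 j w := by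
      intro w hw
      have := ih (by omega) (x := w) (by rw [hsucc]; exact circNEcwL_subset_T c k hk hi hw)
      rwa [hsucc] at this
    have key := MStep.lower_bound (circNEcw ⟨i, hi⟩) c k hk (by interval_cases i <;> simp [circNEcw])
      (by interval_cases i <;> simp [circNEcw])
      (g := fun w => if w ∈ circNEcwL c k i then chainM (circNEcwU c k) (circNEcwL c k) 10 j w else 0)
      (fun w => by split_ifs <;> [exact hM0 w; exact le_rfl]) (circNEcwTailConst_pos (i + 1)).le
      (fun w hw => by
        have hw' : w ∈ circNEcwL c k i := by simp only [circNEcwL, dif_pos hi]; exact hw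
        simp only [hw', if_true]; exact hT w hw') (x := x) (by simp only [circNEcwT, dif_pos hi] at hx; exact hx)
    rw [mul_comm]
    have hU : (circNEcw ⟨i, hi⟩).U c k = circNEcwU c k i := by simp only [circNEcwU, dif_pos hi]
    have hc : (circNEcw ⟨i, hi⟩).const = circNEcwStepConst i := by simp only [circNEcwStepConst, dif_pos hi]
    rw [hU, hc] at key
    exact key

/-- **`M ≥ c_*` on the first start set** (in particular on the start box, `circNEcw_start`): the
free walk performs the whole circuit with probability at least `circNEcwConst`.
[cite: Chelkak2016, Lemma 2.12] -/
theorem circNEcwConst_le_chainM : 0 < k → ∀ x ∈ circNEcwT c k 0,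
    circNEcwConst ≤ chainM (circNEcwU c k) (circNEcwL c k) 10 10 x := by
  intro hk x hx
  have h := circNEcwTailConst_le_chainM c k hk le_rfl (x := x) hx
  have e : circNEcwTailConst (10 - 10) = circNEcwConst := by
    simp only [Nat.sub_self, circNEcwTailConst, circNEcwConst, Finset.range_eq_Ico]
  rw [e] at h; exact h

/-! ### A positive killed chain forces four strip crossings inside `S` -/

/-- One step of the killed circuit inside `S` (wrapper of `exists_walk_of_chainN_pos`). [folklore] -/
theorem circNEcw_iter_step {S : Set (Site 2)} {i : ℕ} (hi : i < 10) {y : Site 2} (hy : y ∈ circNEcwU c k i) (hyS : y ∈ S)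
    (hpos : 0 < chainN (circNEcwU c k) (circNEcwL c k) S 10 (10 - i) y) :
    ∃ y', y' ∈ circNEcwL c k i ∧ y' ∈ S ∧ 0 < chainN (circNEcwU c k) (circNEcwL c k) S 10 (9 - i) y' ∧
      ∃ p : (zdGraph 2).Walk y y', ∀ z ∈ p.support, z ∈ S ∧ (z ∈ circNEcwU c k i ∨ z = y') := by
  have e1 : 10 - 1 - (9 - i) = i := by omega
  have e2 : 10 - i = (9 - i) + 1 := by omega
  rw [e2] at hpos
  have := exists_walk_of_chainN_pos (U := circNEcwU c k) (L := circNEcwL c k) (S := S) (n := 10)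
    (circNEcwU_finite c k) (9 - i) (x := y) (by rw [e1]; exact ⟨hy, hyS⟩) hpos
  rw [e1] at this
  exact this

/-- **Four strip crossings in `S` (the lattice half of Chelkak's crossings-of-annuli lemma).** If
the killed chain of the circuit is positive at a point `x ∈ S` of the first start set with
`x₁ ≥ c₁ - 9k`, then `S` contains a bottom–top crossing of the right strip
`[12k, 36k] × [-36k, -9k]`, a left–right crossing of the bottom strip `[-36k, 36k] × [-36k, -12k]`,
a bottom–top crossing of the left strip `[-36k, -12k] × [-36k, 36k]` and a left–right crossing of
the top strip `[-36k, -9k] × [12k, 36k]` (all relative to `c`). [cite: Chelkak2016, Lemma 2.12] -/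
theorem circNEcw_crossings_of_chainN_pos {S : Set (Site 2)} : 0 < k → ∀ x ∈ circNEcwT c k 0, x ∈ S →
    c 1 - 9 * k ≤ x 1 → 0 < chainN (circNEcwU c k) (circNEcwL c k) S 10 10 x →
    (∃ (u v : Site 2) (σ : (zdGraph 2).Walk u v), u 1 = c 1 - 36 * k ∧ v 1 = c 1 - 9 * k ∧
      ∀ z ∈ σ.support, z ∈ S ∧ c 0 + 12 * k ≤ z 0 ∧ z 0 ≤ c 0 + 36 * k ∧ c 1 - 36 * k ≤ z 1 ∧ z 1 ≤ c 1 - 9 * k) ∧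
    (∃ (u v : Site 2) (σ : (zdGraph 2).Walk u v), u 0 = c 0 - 36 * k ∧ v 0 = c 0 + 36 * k ∧
      ∀ z ∈ σ.support, z ∈ S ∧ c 0 - 36 * k ≤ z 0 ∧ z 0 ≤ c 0 + 36 * k ∧ c 1 - 36 * k ≤ z 1 ∧ z 1 ≤ c 1 - 12 * k) ∧
    (∃ (u v : Site 2) (σ : (zdGraph 2).Walk u v), u 1 = c 1 - 36 * k ∧ v 1 = c 1 + 36 * k ∧
      ∀ z ∈ σ.support, z ∈ S ∧ c 0 - 36 * k ≤ z 0 ∧ z 0 ≤ c 0 - 12 * k ∧ c 1 - 36 * k ≤ z 1 ∧ z 1 ≤ c 1 + 36 * k) ∧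
    (∃ (u v : Site 2) (σ : (zdGraph 2).Walk u v), u 0 = c 0 - 36 * k ∧ v 0 = c 0 - 9 * k ∧
      ∀ z ∈ σ.support, z ∈ S ∧ c 0 - 36 * k ≤ z 0 ∧ z 0 ≤ c 0 - 9 * k ∧ c 1 + 12 * k ≤ z 1 ∧ z 1 ≤ c 1 + 36 * k) := by
  intro hk x hx hxS hx1 hpos
  have hTU : ∀ {i : ℕ} (_ : i + 1 < 10) {y : Site 2}, y ∈ circNEcwL c k i → y ∈ circNEcwU c k (i + 1) :=
    fun {i} hi {y} hy => circNEcwT_subset_U c k hi (circNEcwL_subset_T c k hk (by omega) hy)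
  -- the ten steps
  have hx0 : x ∈ circNEcwU c k 0 := circNEcwT_subset_U c k (by decide) hx
  obtain ⟨y1, hL1, hS1, hp1, p0, hw0⟩ := circNEcw_iter_step c k (by decide : 0 < 10) hx0 hxS hpos
  obtain ⟨y2, hL2, hS2, hp2, -⟩ := circNEcw_iter_step c k (by decide : 1 < 10) (hTU (by decide) hL1) hS1 hp1
  obtain ⟨y3, hL3, hS3, hp3, -⟩ := circNEcw_iter_step c k (by decide : 2 < 10) (hTU (by decide) hL2) hS2 hp2
  obtain ⟨y4, hL4, hS4, hp4, p3, hw3⟩ := circNEcw_iter_step c k (by decide : 3 < 10) (hTU (by decide) hL3) hS3 hp3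
  obtain ⟨y5, hL5, hS5, hp5, -⟩ := circNEcw_iter_step c k (by decide : 4 < 10) (hTU (by decide) hL4) hS4 hp4
  obtain ⟨y6, hL6, hS6, hp6, -⟩ := circNEcw_iter_step c k (by decide : 5 < 10) (hTU (by decide) hL5) hS5 hp5
  obtain ⟨y7, hL7, hS7, hp7, p6, hw6⟩ := circNEcw_iter_step c k (by decide : 6 < 10) (hTU (by decide) hL6) hS6 hp6
  obtain ⟨y8, hL8, hS8, hp8, -⟩ := circNEcw_iter_step c k (by decide : 7 < 10) (hTU (by decide) hL7) hS7 hp7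
  obtain ⟨y9, hL9, hS9, hp9, -⟩ := circNEcw_iter_step c k (by decide : 8 < 10) (hTU (by decide) hL8) hS8 hp8
  obtain ⟨y10, hL10, hS10, -, p9, hw9⟩ := circNEcw_iter_step c k (by decide : 9 < 10) (hTU (by decide) hL9) hS9 hp9
  -- coordinates of the landing points and of the supports
  simp only [circNEcwL, circNEcwU, circNEcw, MStep.L, MStep.U, MStep.corner, rectInterior, Set.mem_setOf_eq,
    Matrix.cons_val_zero, Matrix.cons_val_one, show (0:ℕ) < 10 by decide, show (2:ℕ) < 10 by decide,
    show (3:ℕ) < 10 by decide, show (5:ℕ) < 10 by decide, show (6:ℕ) < 10 by decide, show (8:ℕ) < 10 by decide,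
    show (9:ℕ) < 10 by decide, dif_pos] at hL1 hL3 hL4 hL6 hL7 hL9 hL10 hw0 hw3 hw6 hw9
  simp at hL1 hL3 hL4 hL6 hL7 hL9 hL10 hw0 hw3 hw6 hw9
  refine ⟨?_, ?_, ?_, ?_⟩
  · -- right strip (below the slit) from `p0 : x → y1`, reversed
    obtain ⟨u, v, σ, hu, hv, hsub, hσ⟩ := exists_subwalk_slab p0.reverse 1 (L := c 1 - 36 * k) (R := c 1 - 9 * k)
      (by omega) (by omega) (by omega)
    refine ⟨u, v, σ, hu, hv, fun z hz => ?_⟩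
    have hz' : z ∈ p0.support := by have := hsub z hz; rwa [Walk.support_reverse, List.mem_reverse] at this
    have h1 := hw0 z hz'; have h2 := hσ z hz
    refine ⟨h1.1, ?_, ?_, h2.1, h2.2⟩ <;> rcases h1.2 with h | rfl <;> omega
  · -- bottom strip from `p3 : y3 → y4`, reversed
    obtain ⟨u, v, σ, hu, hv, hsub, hσ⟩ := exists_subwalk_slab p3.reverse 0 (L := c 0 - 36 * k) (R := c 0 + 36 * k)
      (by omega) (by omega) (by omega)
    refine ⟨u, v, σ, hu, hv, fun z hz => ?_⟩
    have hz' : z ∈ p3.support := by have := hsub z hz; rwa [Walk.support_reverse, List.mem_reverse] at this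
    have h1 := hw3 z hz'; have h2 := hσ z hz
    refine ⟨h1.1, h2.1, h2.2, ?_, ?_⟩ <;> rcases h1.2 with h | rfl <;> omega
  · -- left strip from `p6 : y6 → y7`
    obtain ⟨u, v, σ, hu, hv, hsub, hσ⟩ := exists_subwalk_slab p6 1 (L := c 1 - 36 * k) (R := c 1 + 36 * k)
      (by omega) (by omega) (by omega)
    refine ⟨u, v, σ, hu, hv, fun z hz => ?_⟩
    have h1 := hw6 z (hsub z hz); have h2 := hσ z hz
    refine ⟨h1.1, ?_, ?_, h2.1, h2.2⟩ <;> rcases h1.2 with h | rfl <;> omega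
  · -- top strip (left of the slit) from `p9 : y9 → y10`
    obtain ⟨u, v, σ, hu, hv, hsub, hσ⟩ := exists_subwalk_slab p9 0 (L := c 0 - 36 * k) (R := c 0 - 9 * k)
      (by omega) (by omega) (by omega)
    refine ⟨u, v, σ, hu, hv, fun z hz => ?_⟩
    have h1 := hw9 z (hsub z hz); have h2 := hσ z hz
    refine ⟨h1.1, h2.1, h2.2, ?_, ?_⟩ <;> rcases h1.2 with h | rfl <;> omega

end NEcw

end Literature.Probability.LatticeModels
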